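import Mathlib
import Summits.Ventures.PercRepro2.CoinChainXASixTopGate
import Summits.Ventures.PercRepro2.CoinChainXAClosedGateAlg
import Summits.Ventures.PercRepro2.CoinChainXAClosedGateSums

/-!
# The CLOSED GATE of (XA′) is a theorem for EVERY entry structure and every pair of entry markers
(blind cell PercRepro2, night-2 g30)

For the general AND-switch chain with ARBITRARY sure entries `ent` and coin entries `ent'` and the
CLOSED gate `d' ≡ 0` (once the free-arc vertex is entered, the arc `a → w` always connects `s` to `T`),
the cleared (XA′) `Cross ≤ a0·U001` holds for every pair of `{0,1}`-valued increasing markers that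
vanish on the entry-free ideal `I₀ = {W misses ent ∪ ent'}` — in particular for the entry markers
`1[m₁ ∈ ·]`, `1[m₂ ∈ ·]` with `m₁, m₂ ∈ ent ∪ ent'`.  The proof needs only `ν` log-supermodular,
`0 ≤ d ≤ c`, the cross inequality `c(s)d(t) ≤ c(s∩t)d(s∪t)` and the ratio monotonicity of `d/c`:
with `μ := R⁰` (`νc` off the sure-entered clusters, `νd` on them) the functional is the PARTS
inequality `cg_parts` in the masses of `μ` on the ideal, the coin-KILLED part `ν(c − d)` and the
coin-SURVIVING part `νd` of the coin-entered clusters and the sure-entered clusters, and the six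
Holley facts between the parts are instances of the set-level four functions theorem
(`ad_sets`): the killed part is Holley-below the surviving part and below the sure-entered part
(`(c − d)(s)·d(t) ≤ (c − d)(s ∩ t)·d(s ∪ t)`, `closed_gate_pw`), and every `ent`-free cluster is
Holley-below the sure-entered ones.  The fibre-mass Handelman LPs of NIGHT2-DARC.md §71.9i–l could
not certify this statement for three coin entries because the facts they quantified over
(all `(c, u)` fibre masses) do not contain the Holley facts of the KILLED law `ν(c − d)`.
-/

namespace Summit.Ventures.PercRepro2.Coin

open Classical

section ClosedGateFacts

variable {V : Type*} [DecidableEq V] {R : Type*} [Field R] [LinearOrder R] [IsStrictOrderedRing R]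

/-- A product of three bounded nonnegative factors. -/
lemma cg_mul3_le {A A' B B' C C' : R} (hA : A ≤ A') (hB : B ≤ B') (hC : C ≤ C')
    (hB0 : 0 ≤ B) (hC0 : 0 ≤ C) (hA'0 : 0 ≤ A') (hB'0 : 0 ≤ B') :
    A * B * C ≤ A' * B' * C' :=
  mul_le_mul (mul_le_mul hA hB hB0 hA'0) hC hC0 (mul_nonneg hA'0 hB'0)

variable (U ent ent' : Finset V) (ν c d : Finset V → R)
variable (hν0 : ∀ W, 0 ≤ ν W) (hν : ∀ s ⊆ U, ∀ t ⊆ U, ν s * ν t ≤ ν (s ∩ t) * ν (s ∪ t))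
  (hc0 : ∀ W, 0 ≤ c W) (hd0 : ∀ W, 0 ≤ d W) (hdc : ∀ W, d W ≤ c W)
  (hcd : ∀ s t, c s * d t ≤ c (s ∩ t) * d (s ∪ t))
  (hratio : ∀ s t, s ⊆ t → d s * c t ≤ c s * d t)
  (x : Finset V → R) (hx0 : ∀ W, 0 ≤ x W) (hxm : ∀ s t, x s ≤ x (s ∪ t))

include hν0 hν hc0 hd0 hdc hcd hratio hx0 hxm in
/-- **The killed part is Holley-below the surviving part** (`JU`):
`XJ · u ≤ J′ · XU` with `J′` the killed mass of ALL `ent`-free clusters. -/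
theorem cg_fact_JU :
    (∑ W ∈ U.powerset.filter (fun W => (¬ ∃ r ∈ ent, r ∈ W) ∧ ∃ r ∈ ent', r ∈ W), ν W * (c W - d W) * x W)
      * (∑ W ∈ U.powerset.filter (fun W => (¬ ∃ r ∈ ent, r ∈ W) ∧ ∃ r ∈ ent', r ∈ W), ν W * d W) ≤
    (∑ W ∈ U.powerset.filter (fun W => ¬ ∃ r ∈ ent, r ∈ W), ν W * (c W - d W))
      * (∑ W ∈ U.powerset.filter (fun W => (¬ ∃ r ∈ ent, r ∈ W) ∧ ∃ r ∈ ent', r ∈ W), ν W * d W * x W) := by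
  refine ad_sets_dec U (fun W => ν W * (c W - d W) * x W) (fun W => ν W * d W)
    (fun W => ν W * (c W - d W)) (fun W => ν W * d W * x W)
    (fun W => mul_nonneg (mul_nonneg (hν0 W) (by linarith [hdc W])) (hx0 W))
    (fun W => mul_nonneg (hν0 W) (hd0 W)) (fun W => mul_nonneg (hν0 W) (by linarith [hdc W]))
    (fun W => mul_nonneg (mul_nonneg (hν0 W) (hd0 W)) (hx0 W))
    (fun W => (¬ ∃ r ∈ ent, r ∈ W) ∧ ∃ r ∈ ent', r ∈ W) (fun W => (¬ ∃ r ∈ ent, r ∈ W) ∧ ∃ r ∈ ent', r ∈ W)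
    (fun W => ¬ ∃ r ∈ ent, r ∈ W) (fun W => (¬ ∃ r ∈ ent, r ∈ W) ∧ ∃ r ∈ ent', r ∈ W) ?_
  intro s hs t ht hA hB
  refine ⟨fun ⟨r, hr, hrW⟩ => hA.1 ⟨r, hr, (Finset.mem_inter.1 hrW).1⟩,
    ⟨fun ⟨r, hr, hrW⟩ => (Finset.mem_union.1 hrW).elim (fun h => hA.1 ⟨r, hr, h⟩) (fun h => hB.1 ⟨r, hr, h⟩),
      by obtain ⟨r, hr, hrW⟩ := hA.2; exact ⟨r, hr, Finset.mem_union.2 (Or.inl hrW)⟩⟩, ?_⟩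
  calc ν s * (c s - d s) * x s * (ν t * d t)
      = (ν s * ν t) * ((c s - d s) * d t) * x s := by ring
    _ ≤ (ν (s ∩ t) * ν (s ∪ t)) * ((c (s ∩ t) - d (s ∩ t)) * d (s ∪ t)) * x (s ∪ t) :=
        cg_mul3_le (hν s hs t ht) (closed_gate_pw c d hc0 hd0 hdc hcd hratio s t) (hxm s t)
          (mul_nonneg (by linarith [hdc s]) (hd0 t)) (hx0 s) (mul_nonneg (hν0 _) (hν0 _))
          (mul_nonneg (by linarith [hdc (s ∩ t)]) (hd0 _))
    _ = ν (s ∩ t) * (c (s ∩ t) - d (s ∩ t)) * (ν (s ∪ t) * d (s ∪ t) * x (s ∪ t)) := by ring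

include hν0 hν hc0 hd0 hdc hcd hratio hx0 hxm in
/-- **The killed part is Holley-below the sure-entered clusters** (`JM`):
`XJ · t ≤ J′ · XM`. -/
theorem cg_fact_JM :
    (∑ W ∈ U.powerset.filter (fun W => (¬ ∃ r ∈ ent, r ∈ W) ∧ ∃ r ∈ ent', r ∈ W), ν W * (c W - d W) * x W)
      * (∑ W ∈ U.powerset.filter (fun W => ∃ r ∈ ent, r ∈ W), ν W * d W) ≤
    (∑ W ∈ U.powerset.filter (fun W => ¬ ∃ r ∈ ent, r ∈ W), ν W * (c W - d W))
      * (∑ W ∈ U.powerset.filter (fun W => ∃ r ∈ ent, r ∈ W), ν W * d W * x W) := by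
  refine ad_sets_dec U (fun W => ν W * (c W - d W) * x W) (fun W => ν W * d W)
    (fun W => ν W * (c W - d W)) (fun W => ν W * d W * x W)
    (fun W => mul_nonneg (mul_nonneg (hν0 W) (by linarith [hdc W])) (hx0 W))
    (fun W => mul_nonneg (hν0 W) (hd0 W)) (fun W => mul_nonneg (hν0 W) (by linarith [hdc W]))
    (fun W => mul_nonneg (mul_nonneg (hν0 W) (hd0 W)) (hx0 W))
    (fun W => (¬ ∃ r ∈ ent, r ∈ W) ∧ ∃ r ∈ ent', r ∈ W) (fun W => ∃ r ∈ ent, r ∈ W)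
    (fun W => ¬ ∃ r ∈ ent, r ∈ W) (fun W => ∃ r ∈ ent, r ∈ W) ?_
  intro s hs t ht hA hB
  refine ⟨fun ⟨r, hr, hrW⟩ => hA.1 ⟨r, hr, (Finset.mem_inter.1 hrW).1⟩,
    by obtain ⟨r, hr, hrW⟩ := hB; exact ⟨r, hr, Finset.mem_union.2 (Or.inr hrW)⟩, ?_⟩
  calc ν s * (c s - d s) * x s * (ν t * d t)
      = (ν s * ν t) * ((c s - d s) * d t) * x s := by ring
    _ ≤ (ν (s ∩ t) * ν (s ∪ t)) * ((c (s ∩ t) - d (s ∩ t)) * d (s ∪ t)) * x (s ∪ t) :=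
        cg_mul3_le (hν s hs t ht) (closed_gate_pw c d hc0 hd0 hdc hcd hratio s t) (hxm s t)
          (mul_nonneg (by linarith [hdc s]) (hd0 t)) (hx0 s) (mul_nonneg (hν0 _) (hν0 _))
          (mul_nonneg (by linarith [hdc (s ∩ t)]) (hd0 _))
    _ = ν (s ∩ t) * (c (s ∩ t) - d (s ∩ t)) * (ν (s ∪ t) * d (s ∪ t) * x (s ∪ t)) := by ring

include hν0 hν hc0 hd0 hcd hx0 hxm in
/-- **The `ent`-free clusters are Holley-below the sure-entered ones** (`McM`):
`(XJ + XU) · t ≤ (J + u) · XM` with `XJ + XU` the `c`-marker mass of the coin-entered clusters. -/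
theorem cg_fact_McM :
    (∑ W ∈ U.powerset.filter (fun W => (¬ ∃ r ∈ ent, r ∈ W) ∧ ∃ r ∈ ent', r ∈ W), ν W * c W * x W)
      * (∑ W ∈ U.powerset.filter (fun W => ∃ r ∈ ent, r ∈ W), ν W * d W) ≤
    (∑ W ∈ U.powerset.filter (fun W => ¬ ∃ r ∈ ent, r ∈ W), ν W * c W)
      * (∑ W ∈ U.powerset.filter (fun W => ∃ r ∈ ent, r ∈ W), ν W * d W * x W) := by
  refine ad_sets_dec U (fun W => ν W * c W * x W) (fun W => ν W * d W)
    (fun W => ν W * c W) (fun W => ν W * d W * x W)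
    (fun W => mul_nonneg (mul_nonneg (hν0 W) (hc0 W)) (hx0 W))
    (fun W => mul_nonneg (hν0 W) (hd0 W)) (fun W => mul_nonneg (hν0 W) (hc0 W))
    (fun W => mul_nonneg (mul_nonneg (hν0 W) (hd0 W)) (hx0 W))
    (fun W => (¬ ∃ r ∈ ent, r ∈ W) ∧ ∃ r ∈ ent', r ∈ W) (fun W => ∃ r ∈ ent, r ∈ W)
    (fun W => ¬ ∃ r ∈ ent, r ∈ W) (fun W => ∃ r ∈ ent, r ∈ W) ?_
  intro s hs t ht hA hB
  refine ⟨fun ⟨r, hr, hrW⟩ => hA.1 ⟨r, hr, (Finset.mem_inter.1 hrW).1⟩,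
    by obtain ⟨r, hr, hrW⟩ := hB; exact ⟨r, hr, Finset.mem_union.2 (Or.inr hrW)⟩, ?_⟩
  calc ν s * c s * x s * (ν t * d t)
      = (ν s * ν t) * (c s * d t) * x s := by ring
    _ ≤ (ν (s ∩ t) * ν (s ∪ t)) * (c (s ∩ t) * d (s ∪ t)) * x (s ∪ t) :=
        cg_mul3_le (hν s hs t ht) (hcd s t) (hxm s t)
          (mul_nonneg (hc0 s) (hd0 t)) (hx0 s) (mul_nonneg (hν0 _) (hν0 _))
          (mul_nonneg (hc0 _) (hd0 _))
    _ = ν (s ∩ t) * c (s ∩ t) * (ν (s ∪ t) * d (s ∪ t) * x (s ∪ t)) := by ring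

end ClosedGateFacts

section ClosedGateMain

variable {V : Type*} [DecidableEq V] {R : Type*} [Field R] [LinearOrder R] [IsStrictOrderedRing R]

/-- **THE CLOSED GATE OF (XA′)** for EVERY entry structure `ent`, `ent'` and every pair of
nonnegative increasing markers (`x ≤ 1`) that vanish on the entry-free ideal: the cleared
(XA′) `Cross ≤ a0·U001` with the gate `d' ≡ 0` — the hypothesis `hXA'` of
`chain_functional_nonneg_of_XA'` at `d' := fun _ => 0`.  Needs only `ν` log-supermodular,
`0 ≤ d ≤ c`, the cross inequality `(c, d)` and the ratio monotonicity of `d / c`. -/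
theorem chain_XA'_closed_gate (U ent ent' : Finset V) (ν c d : Finset V → R)
    (hν0 : ∀ W, 0 ≤ ν W) (hν : ∀ s ⊆ U, ∀ t ⊆ U, ν s * ν t ≤ ν (s ∩ t) * ν (s ∪ t))
    (hc0 : ∀ W, 0 ≤ c W) (hd0 : ∀ W, 0 ≤ d W) (hdc : ∀ W, d W ≤ c W)
    (hcd : ∀ s t, c s * d t ≤ c (s ∩ t) * d (s ∪ t))
    (hratio : ∀ s t, s ⊆ t → d s * c t ≤ c s * d t)
    (x y : Finset V → R) (hx0 : ∀ W, 0 ≤ x W) (hy0 : ∀ W, 0 ≤ y W)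
    (hx1 : ∀ W, x W ≤ 1)
    (hxm : ∀ s t, x s ≤ x (s ∪ t)) (hym : ∀ s t, y s ≤ y (s ∪ t))
    (hxI : ∀ W, (¬ ∃ r ∈ ent ∪ ent', r ∈ W) → x W = 0)
    (hyI : ∀ W, (¬ ∃ r ∈ ent ∪ ent', r ∈ W) → y W = 0) :
    (((∑ W ∈ U.powerset, ν W * chainMix ent ent' 0 c d W) * (∑ W ∈ U.powerset, ν W * chainMix ent ent' 1 c d W * x W) - (∑ W ∈ U.powerset, ν W * chainMix ent ent' 0 c d W * x W) * (∑ W ∈ U.powerset, ν W * chainMix ent ent' 1 c d W)) *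
          ((∑ W ∈ U.powerset, ν W * chainMix ent ent' 0 c d W) * (∑ W ∈ U.powerset, ν W * chainMix ent ent' 0 c (fun _ => (0 : R)) W * y W) - (∑ W ∈ U.powerset, ν W * chainMix ent ent' 0 c d W * y W) * (∑ W ∈ U.powerset, ν W * chainMix ent ent' 0 c (fun _ => (0 : R)) W))
        + ((∑ W ∈ U.powerset, ν W * chainMix ent ent' 0 c d W) * (∑ W ∈ U.powerset, ν W * chainMix ent ent' 1 c d W * y W) - (∑ W ∈ U.powerset, ν W * chainMix ent ent' 0 c d W * y W) * (∑ W ∈ U.powerset, ν W * chainMix ent ent' 1 c d W)) *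
          ((∑ W ∈ U.powerset, ν W * chainMix ent ent' 0 c d W) * (∑ W ∈ U.powerset, ν W * chainMix ent ent' 0 c (fun _ => (0 : R)) W * x W) - (∑ W ∈ U.powerset, ν W * chainMix ent ent' 0 c d W * x W) * (∑ W ∈ U.powerset, ν W * chainMix ent ent' 0 c (fun _ => (0 : R)) W))) ≤
        (∑ W ∈ U.powerset, ν W * chainMix ent ent' 0 c d W) * ((∑ W ∈ U.powerset, ν W * chainMix ent ent' 0 c d W) * (∑ W ∈ U.powerset, ν W * chainMix ent ent' 0 c d W) * (∑ W ∈ U.powerset, ν W * chainMix ent ent' 1 c (fun _ => (0 : R)) W * (x W * y W))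
          - (∑ W ∈ U.powerset, ν W * chainMix ent ent' 0 c d W) * (∑ W ∈ U.powerset, ν W * chainMix ent ent' 0 c d W * y W) * (∑ W ∈ U.powerset, ν W * chainMix ent ent' 1 c (fun _ => (0 : R)) W * x W)
          - (∑ W ∈ U.powerset, ν W * chainMix ent ent' 0 c d W) * (∑ W ∈ U.powerset, ν W * chainMix ent ent' 0 c d W * x W) * (∑ W ∈ U.powerset, ν W * chainMix ent ent' 1 c (fun _ => (0 : R)) W * y W)
          + (∑ W ∈ U.powerset, ν W * chainMix ent ent' 0 c d W * x W) * (∑ W ∈ U.powerset, ν W * chainMix ent ent' 0 c d W * y W) * (∑ W ∈ U.powerset, ν W * chainMix ent ent' 1 c (fun _ => (0 : R)) W)) := by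
  have hxyI : ∀ W, (¬ ∃ r ∈ ent ∪ ent', r ∈ W) → x W * y W = 0 := fun W h => by rw [hxI W h, zero_mul]
  -- the thirteen moments in terms of the part sums
  rw [cg_a0 U ent ent' ν c d, cg_a1 U ent ent' ν c d x hxI, cg_a1 U ent ent' ν c d y hyI,
    cg_b0 U ent ent' ν c d, cg_b1 U ent ent' ν c d x hxI, cg_b1 U ent ent' ν c d y hyI,
    cg_e0 U ent ent' ν c, cg_e1 U ent ent' ν c x hxI, cg_e1 U ent ent' ν c y hyI,
    cg_g0 U ent ent' ν c, cg_g1 U ent ent' ν c x hxI, cg_g1 U ent ent' ν c y hyI,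
    cg_g1 U ent ent' ν c (fun W => x W * y W) hxyI,
    cg_split' U ν c d (fun W => (¬ ∃ r ∈ ent, r ∈ W) ∧ ∃ r ∈ ent', r ∈ W),
    cg_split U ν c d (fun W => (¬ ∃ r ∈ ent, r ∈ W) ∧ ∃ r ∈ ent', r ∈ W) x,
    cg_split U ν c d (fun W => (¬ ∃ r ∈ ent, r ∈ W) ∧ ∃ r ∈ ent', r ∈ W) y]
  -- the ten part sums
  set a := ∑ W ∈ U.powerset.filter (fun W => ¬ ∃ r ∈ ent ∪ ent', r ∈ W), ν W * c W with ha_def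
  set δ := ∑ W ∈ U.powerset.filter (fun W => (¬ ∃ r ∈ ent, r ∈ W) ∧ ∃ r ∈ ent', r ∈ W), ν W * (c W - d W) with hδ_def
  set u := ∑ W ∈ U.powerset.filter (fun W => (¬ ∃ r ∈ ent, r ∈ W) ∧ ∃ r ∈ ent', r ∈ W), ν W * d W with hu_def
  set t := ∑ W ∈ U.powerset.filter (fun W => ∃ r ∈ ent, r ∈ W), ν W * d W with ht_def
  set XJ := ∑ W ∈ U.powerset.filter (fun W => (¬ ∃ r ∈ ent, r ∈ W) ∧ ∃ r ∈ ent', r ∈ W), ν W * (c W - d W) * x W with hXJ_def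
  set XU := ∑ W ∈ U.powerset.filter (fun W => (¬ ∃ r ∈ ent, r ∈ W) ∧ ∃ r ∈ ent', r ∈ W), ν W * d W * x W with hXU_def
  set XM := ∑ W ∈ U.powerset.filter (fun W => ∃ r ∈ ent, r ∈ W), ν W * d W * x W with hXM_def
  set YJ := ∑ W ∈ U.powerset.filter (fun W => (¬ ∃ r ∈ ent, r ∈ W) ∧ ∃ r ∈ ent', r ∈ W), ν W * (c W - d W) * y W with hYJ_def
  set YU := ∑ W ∈ U.powerset.filter (fun W => (¬ ∃ r ∈ ent, r ∈ W) ∧ ∃ r ∈ ent', r ∈ W), ν W * d W * y W with hYU_def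
  set YM := ∑ W ∈ U.powerset.filter (fun W => ∃ r ∈ ent, r ∈ W), ν W * d W * y W with hYM_def
  -- nonnegativity
  have hcd0 : ∀ W, 0 ≤ c W - d W := fun W => by linarith [hdc W]
  have ha : 0 ≤ a := Finset.sum_nonneg (fun W _ => mul_nonneg (hν0 W) (hc0 W))
  have hu : 0 ≤ u := Finset.sum_nonneg (fun W _ => mul_nonneg (hν0 W) (hd0 W))
  have ht : 0 ≤ t := Finset.sum_nonneg (fun W _ => mul_nonneg (hν0 W) (hd0 W))
  have hXJ : 0 ≤ XJ := Finset.sum_nonneg (fun W _ => mul_nonneg (mul_nonneg (hν0 W) (hcd0 W)) (hx0 W))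
  have hXU : 0 ≤ XU := Finset.sum_nonneg (fun W _ => mul_nonneg (mul_nonneg (hν0 W) (hd0 W)) (hx0 W))
  have hXM : 0 ≤ XM := Finset.sum_nonneg (fun W _ => mul_nonneg (mul_nonneg (hν0 W) (hd0 W)) (hx0 W))
  have hYJ : 0 ≤ YJ := Finset.sum_nonneg (fun W _ => mul_nonneg (mul_nonneg (hν0 W) (hcd0 W)) (hy0 W))
  have hYU : 0 ≤ YU := Finset.sum_nonneg (fun W _ => mul_nonneg (mul_nonneg (hν0 W) (hd0 W)) (hy0 W))
  have hYM : 0 ≤ YM := Finset.sum_nonneg (fun W _ => mul_nonneg (mul_nonneg (hν0 W) (hd0 W)) (hy0 W))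
  -- the box facts
  have hXJδ : 0 ≤ δ - XJ := by
    have : XJ ≤ δ := Finset.sum_le_sum (fun W _ =>
      mul_le_of_le_one_right (mul_nonneg (hν0 W) (hcd0 W)) (hx1 W))
    linarith
  have hXUu : 0 ≤ u - XU := by
    have : XU ≤ u := Finset.sum_le_sum (fun W _ =>
      mul_le_of_le_one_right (mul_nonneg (hν0 W) (hd0 W)) (hx1 W))
    linarith
  have hXMt : 0 ≤ t - XM := by
    have : XM ≤ t := Finset.sum_le_sum (fun W _ =>
      mul_le_of_le_one_right (mul_nonneg (hν0 W) (hd0 W)) (hx1 W))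
    linarith
  -- the killed mass of the ideal is at most its `c`-mass
  have ha' : ∑ W ∈ U.powerset.filter (fun W => ¬ ∃ r ∈ ent ∪ ent', r ∈ W), ν W * (c W - d W) ≤ a :=
    Finset.sum_le_sum (fun W _ => mul_le_mul_of_nonneg_left (by linarith [hd0 W]) (hν0 W))
  -- the six Holley facts
  have F1x := cg_fact_JU U ent ent' ν c d hν0 hν hc0 hd0 hdc hcd hratio x hx0 hxm
  have F2x := cg_fact_JM U ent ent' ν c d hν0 hν hc0 hd0 hdc hcd hratio x hx0 hxm
  have F3x := cg_fact_McM U ent ent' ν c d hν0 hν hc0 hd0 hcd x hx0 hxm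
  have F1y := cg_fact_JU U ent ent' ν c d hν0 hν hc0 hd0 hdc hcd hratio y hy0 hym
  have F2y := cg_fact_JM U ent ent' ν c d hν0 hν hc0 hd0 hdc hcd hratio y hy0 hym
  have F3y := cg_fact_McM U ent ent' ν c d hν0 hν hc0 hd0 hcd y hy0 hym
  rw [sum_entfree_split U ent ent' (fun W => ν W * (c W - d W))] at F1x F2x F1y F2y
  rw [sum_entfree_split U ent ent' (fun W => ν W * c W),
    cg_split' U ν c d (fun W => (¬ ∃ r ∈ ent, r ∈ W) ∧ ∃ r ∈ ent', r ∈ W),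
    cg_split U ν c d (fun W => (¬ ∃ r ∈ ent, r ∈ W) ∧ ∃ r ∈ ent', r ∈ W)] at F3x F3y
  have hJUx : 0 ≤ XU * (a + δ) - XJ * u := by
    have := mul_le_mul_of_nonneg_right ha' hXU
    linear_combination F1x + this
  have hJMx : 0 ≤ XM * (a + δ) - XJ * t := by
    have := mul_le_mul_of_nonneg_right ha' hXM
    linear_combination F2x + this
  have hMcMx : 0 ≤ XM * (a + δ + u) - (XJ + XU) * t := by linear_combination F3x
  have hJUy : 0 ≤ YU * (a + δ) - YJ * u := by
    have := mul_le_mul_of_nonneg_right ha' hYU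
    linear_combination F1y + this
  have hJMy : 0 ≤ YM * (a + δ) - YJ * t := by
    have := mul_le_mul_of_nonneg_right ha' hYM
    linear_combination F2y + this
  have hMcMy : 0 ≤ YM * (a + δ + u) - (YJ + YU) * t := by linear_combination F3y
  have key := cg_parts a δ u t XJ XU XM YJ YU YM ha hu ht hXJ hXU hXM hYJ hYU hYM
    hJUx hJMx hMcMx hJUy hJMy hMcMy hXJδ hXUu hXMt
  linear_combination key

end ClosedGateMain

end Summit.Ventures.PercRepro2.Coin
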